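import Literature.MathematicalPhysics.QuantumFieldTheory.Balaban1983to89.B9Thm313WholeHolder
import Literature.MathematicalPhysics.QuantumFieldTheory.Balaban1983to89.B9Thm313WholeLeftZ

/-!
# `Balaban1983to89.B9Thm313WholeHolderZ` — [B9] Theorem 3.13 (p. 426): the two (3.43) HÖLDER-PROBE members of 𝔊 through (3.153) with the COARSE-FIELD
# LETTERS RE-CLASSED (Z-twin of `B9Thm313WholeHolder`; R1-cls of the cell's located «C-LETTER-FLAT-AT-ONE»; sequel of `B9Thm313WholeZ ∕ LeftZ`)

T. Bałaban, *Propagators for lattice gauge theories in a background field*, Commun. Math. Phys. **99** (1985) 389–434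
[`Balaban1985BackgroundPropagators`, "B9"]; [4] = T. Bałaban, *Propagators and renormalization transformations for lattice
gauge theories. II*, Commun. Math. Phys. **96** (1984) 223–250 [`Balaban1984PropagatorsII`].  statement-level skeleton of published
theorems with citation tags; proofs where landed; nothing here is a claim about the Yang–Mills mass gap.

THE POINT.  `B9Thm313WholeHolder.GG_probe43L_of_letters ∕ GG_probe43R_of_letters` read the factorisation (E G₁Q\*)·(QG₁Q\*)⁻¹·(QG₁𝒳) of (3.153) through the
FLAT coarse classes Z⁰ ∕ Z^{len} (as real classes 𝔠_Z^{(0)} ∕ 𝔠_Z^{(1)}), located unsatisfiable at the knit's flat pins (n06-h: (QGQ\*)⁻¹ alone carries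
L^{+jD}).  Here the middle class is the WEIGHTED sharp-block class of `B9Thm313WholeZ`: `Z_{wZ} = weightNorm (ofBlocks blkZ) wZ` on the undifferentiated
side, `Z_{len·wZ}` on the differentiated side, one free positive weight `wZ`:
* §1 `Letters313HZ 𝔬 𝔭 R₀ H₀ hG wZ hwZ bW BhD Bx δ₃ U` — `Letters313H` with `pXQs` sourced at `Z_{len·wZ}` (and `GeoOK` for the bare `hlen`);
* §2 ★ `GG_probe43L_of_lettersZ` (`hpQ` out of `Z_{wZ}`, `hL : Letters313Z`), ★ `GG_probe43R_of_lettersZ` (`hpQs` out of `Z_{len·wZ}`) — SAME conclusions and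
  constants `constH313 …` as the flat versions; proofs verbatim but for the one-sided conversions `hasMaj_toR_tgt ∕ hasMaj_toR_src` around the weighted
  class (which is not a power class) and its cutting cost `weightNorm_ofBlocks_κ = 1`.
`wZ ≡ 1` recovers the flat statements (definitionally `cNorm … 0 = weightNorm … (wt g 0)`).

HONEST SCOPE.  Nothing of print is asserted: the letters are HYPOTHESES of printed ∕ md shape; kernel-checked bookkeeping of (3.153) with outer factors.
NOT a node discharge, NOT summit progress; one finite lattice at a time; nothing continuum, nothing about the mass gap.  Cell `pub-ymgap` (HUMAN RULING
D-0062), Track A node N06 [B9], N06-ASSIGNMENT v1 row 21 (bundle F7), seat `pub-ymgap-dag-n06-l` (g14), 2026-08-27.  NEW file; nothing landed is modified.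
-/

namespace Literature.MathematicalPhysics.QuantumFieldTheory.Balaban1983to89.B9Thm313WholeHolderZ

open Literature.MathematicalPhysics.QuantumFieldTheory.Balaban1983to89
open Finset B6RandomWalk B6RandomWalkHom B9Thm34Ext B9Thm37GlueCor36 B11SectG B9SectDSup
open B9Thm37AllNorms B9Thm37AllNormsInstances B9Thm312Whole B9Thm312WholeLeaf B9Thm312WholeLeft B9Thm313Whole B9Thm313WholeLeft
open B9RWSums343Holder B9Ineq347 B9Thm312WholeClasses B9Thm312WholeHolder B9Thm312WholeHHolder B9Thm313WholeHolder
open B9Thm313WholeZ B9Thm313WholeLeftZ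

noncomputable section

/-! ## §1 The letters of the two (3.43) reductions in the probe classes, coarse class re-weighted -/

section Letters

variable {g : B9.Geometry} {B : B9.Backgrounds} {X Y Z W PX PY : Type} [Fintype X] [Fintype Z] [Fintype W] [Fintype PX] [Fintype PY]
  [Fintype g.Site]

/-- **THE LETTERS OF THE (3.43) REDUCTIONS OF 𝔊 AT U, COARSE CLASS RE-WEIGHTED** (`B9Thm313WholeHolder.Letters313H` with `pXQs` sourced at the weighted
class `Z_{len·wZ} = weightNorm (ofBlocks blkZ) (len·wZ)` of `B9Thm313WholeZ.Letters313Z.gQs1`, and `GeoOK` in place of the bare `hlen`) — hypotheses of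
printed ∕ md shape, nothing asserted: `pYDH β` = the Hölder probe of the MIXED
entry ∇_UG₀D OUT OF the scalar-field Hölder class `bW` (the probe twin of `Letters313D.dgDH`: (3.45)-type for G₀ with the gauge derivative D of [4]
(2.26) on the right; between pure sup classes this is false, whence `bW`); `pXDv β` = the Hölder probe of G₀D from the scalar sup class W⁰ (the
probe twin of `Letters313.gD1`, species (3.43)₂: *"‖ζG′∇\*_Uλ‖_β ≦ … |λ|"* with D for ∇\*); `pXQs β` = the Hölder probe of G₀Q* from the weighted coarse
class Z_{len·wZ} (the probe twin of `Letters313Z.gQs1`); constants `BhD β`, `Bx β`, rate δ₃.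
[cite: Balaban1985BackgroundPropagators, Thm 3.13 p.426 + (3.152)–(3.153) p.426 + (3.43)–(3.45) p.398 + (3.49) p.399; Balaban1984PropagatorsII, (2.26) p.228] -/
structure Letters313HZ (𝔬 : Ops g B X Y Z W) (𝔭 : HolderProbes g B X Y PX PY) (R₀ : ℝ) (H₀ : Prop)
    (hG : GeoOK g) (wZ : g.Site → ℝ) (hwZ : ∀ y, 0 < wZ y) (bW : BlockNorm (toB6 g R₀ H₀) (W → ℝ)) (BhD Bx : ℝ → ℝ) (δ₃ : ℝ)
    (U : B.Cfg) : Prop where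
  pYDH : ∀ β : ℝ, 0 ≤ β → β < 1 → HasMaj bW (cNormR R₀ H₀ 𝔭.blkPY hG.lenle (β - 1)) ((𝔭.ΦY U β ∘ₗ 𝔬.D U ∘ₗ 𝔬.G0 U) ∘ₗ 𝔬.Dv U)
    (fun a b => BhD β * Real.exp (-(δ₃ * g.dist a b)))
  pXDv : ∀ β : ℝ, 0 ≤ β → β < 1 → HasMaj (cNormR R₀ H₀ 𝔬.blkW hG.lenle 0) (cNormR R₀ H₀ 𝔭.blkPX hG.lenle (β - 1)) ((𝔭.ΦX U β ∘ₗ 𝔬.G0 U) ∘ₗ 𝔬.Dv U)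
    (fun a b => Bx β * Real.exp (-(δ₃ * g.dist a b)))
  pXQs : ∀ β : ℝ, 0 ≤ β → β < 1 → HasMaj (weightNorm (BlockNorm.ofBlocks (toB6 g R₀ H₀) 𝔬.blkZ) (fun y => g.len y * wZ y) fun y => (wZlen_pos hG hwZ y).le)
    (cNormR R₀ H₀ 𝔭.blkPX hG.lenle (β - 1)) ((𝔭.ΦX U β ∘ₗ 𝔬.G0 U) ∘ₗ 𝔬.Qstar U) (fun a b => Bx β * Real.exp (-(δ₃ * g.dist a b)))

end Letters

/-! ## §2 One member, one U: the two (3.43) probe majorants of 𝔊 over the re-classed letters -/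

section OneMember

variable {g : B9.Geometry} {B : B9.Backgrounds} {X Y Z W PX PY : Type}
variable [Fintype X] [Fintype Y] [Fintype Z] [Fintype W] [Fintype PX] [Fintype PY] [Fintype g.Site]
variable {R₀ : ℝ} {H₀ : Prop}

omit [Fintype PX] in
/-- ★ **THEOREM 3.13, THE LEFT (3.43) MEMBER OF 𝔊 — Φ^Y_β∘∇_U∘𝔊 through (3.153), COARSE LETTERS RE-CLASSED** (statement of
`B9Thm313WholeHolder.GG_probe43L_of_letters` over `Letters313Z`, `hpQ` out of `Z_{wZ}`; proof verbatim with one-sided class conversions), the probe twin of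
`B9Thm313WholeLeftZ.GG_entry1_of_lettersZ`: from Theorem
3.3's (3.42)₁ (`he0`) and the probe of (3.43)₁ (`h43`) for G₀, the step K′₁ = G₀(Δ′_π + Δ⁽²⁾_π) on 𝔠⁽²⁾ (`hK`, θc < 1) and its Hölder probe (`hpY`, θ_He^{−δ_Kd}),
the resolvent identity, the letters of `Letters313Z` (`gD2 gQs2 rgd2 c1_2 q2`, coarse class `Z_{wZ}`), `Letters313DZ.rgdH` (into the scalar Hölder class `bW`), the probe letters
`hpQ` (Φ∇G₀Q* out of `Z_{wZ}`, `LettersHHZ.pQ`) and `hpD` (Φ∇G₀D out of `bW`, `Letters313H.pYDH`), and (3.153): Φ^Y_β∘∇_U∘𝔊 has majorant `constH313 …`·e^{−ρ′d} from 𝔠^{(0)}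
into the probe class 𝔠_P^{(β−1)} (ρ′ + 3σ ≦ ρ ≦ min(δ₀, δ₃), ρ + σ ≦ δ_K), whence the two-space shape C·(Lʲη)^{1−β}e^{−ρ′d}.
[cite: Balaban1985BackgroundPropagators, Thm 3.13 p.426 + (3.152)–(3.153) p.426 + (3.138) p.423 + (3.43) p.398] -/
theorem GG_probe43L_of_lettersZ (hG : GeoOK g) {𝔬 : Ops g B X Y Z W} (𝔭 : HolderProbes g B X Y PX PY) {U : B.Cfg}
    {bW : BlockNorm (toB6 g R₀ H₀) (W → ℝ)} {θ θH B₀ B₃ Bh Bq Bd β δ₀ δ₃ δK ρ ρ' σ c : ℝ} (hrow : RowSum (toB6 g R₀ H₀) σ c) (hc : 0 ≤ c)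
    (hθ : 0 ≤ θ) (hθH : 0 ≤ θH) (hB₀ : 0 ≤ B₀) (hB₃ : 0 ≤ B₃) (hBh : 0 ≤ Bh) (hBq : 0 ≤ Bq) (hBd : 0 ≤ Bd) (hσ : 0 ≤ σ) (hρ' : 0 ≤ ρ')
    (hρ'ρ : ρ' + 3 * σ ≤ ρ) (hρS : ρ ≤ δ₀) (hρ₃ : ρ ≤ δ₃) (hρδ : ρ + σ ≤ δK) (hq : θ * c < 1)
    (hK : HasMaj (cNorm R₀ H₀ 𝔬.blk hG.lenle 2) (cNorm R₀ H₀ 𝔬.blk hG.lenle 2) (𝔬.G0 U ∘ₗ (𝔬.Tpi U + 𝔬.T2 U))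
      (fun a b => θ * Real.exp (-(δK * g.dist a b))))
    (he0 : HasMajorant (g := toB6 g R₀ H₀) 𝔬.blk (𝔬.G0 U) (fun a b => B₀ * g.len a ^ 2 * Real.exp (-(δ₀ * g.dist a b))))
    (h43 : HasMajorantHom (g := toB6 g R₀ H₀) 𝔬.blk 𝔭.blkPY (𝔭.ΦY U β ∘ₗ (𝔬.D U ∘ₗ 𝔬.G0 U))
      (fun (a b : g.Site) => Bh * g.len a ^ (1 - β) * Real.exp (-(δ₀ * g.dist a b))))
    (hpY : HasMaj (cNormR R₀ H₀ 𝔬.blk hG.lenle (-2)) (cNormR R₀ H₀ 𝔭.blkPY hG.lenle (β - 1))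
      ((𝔭.ΦY U β ∘ₗ 𝔬.D U ∘ₗ 𝔬.G0 U) ∘ₗ (𝔬.Tpi U + 𝔬.T2 U)) (fun a b => θH * Real.exp (-(δK * g.dist a b))))
    {wZ : g.Site → ℝ} {hwZ : ∀ y, 0 < wZ y}
    (hpQ : HasMaj (weightNorm (BlockNorm.ofBlocks (toB6 g R₀ H₀) 𝔬.blkZ) wZ fun y => (hwZ y).le) (cNormR R₀ H₀ 𝔭.blkPY hG.lenle (β - 1))
      ((𝔭.ΦY U β ∘ₗ 𝔬.D U ∘ₗ 𝔬.G0 U) ∘ₗ 𝔬.Qstar U) (fun a b => Bq * Real.exp (-(δ₃ * g.dist a b))))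
    (hpD : HasMaj bW (cNormR R₀ H₀ 𝔭.blkPY hG.lenle (β - 1)) ((𝔭.ΦY U β ∘ₗ 𝔬.D U ∘ₗ 𝔬.G0 U) ∘ₗ 𝔬.Dv U)
      (fun a b => Bd * Real.exp (-(δ₃ * g.dist a b))))
    (hL : Letters313Z 𝔬 R₀ H₀ hG wZ hwZ B₃ δ₃ U) (hrgdH : HasMaj (cNorm R₀ H₀ 𝔬.blk hG.lenle 0) bW
      (𝔬.R U ∘ₗ 𝔬.Dvstar U ∘ₗ 𝔬.G1 U ∘ₗ LinearMap.id) (fun a b => B₃ * Real.exp (-(δ₃ * g.dist a b))))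
    (hI : Identities 𝔬 U) :
    HasMajorantHom (g := toB6 g R₀ H₀) 𝔬.blk 𝔭.blkPY (𝔭.ΦY U β ∘ₗ (𝔬.D U ∘ₗ 𝔬.GG U))
      (fun (a b : g.Site) => constH313 (Bh + θH * (B₀ * (1 - θ * c)⁻¹) * c) θH (B₀ * (1 - θ * c)⁻¹) (B₃ * (1 - θ * c)⁻¹) B₃ Bd Bq bW.κ c *
        g.len a ^ (1 - β) * Real.exp (-(ρ' * g.dist a b))) := by
  have hq1 : 0 ≤ (1 - θ * c)⁻¹ := inv_nonneg.mpr (by linarith)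
  have hA₁ : 0 ≤ B₀ * (1 - θ * c)⁻¹ := mul_nonneg hB₀ hq1
  have hA₃ : 0 ≤ B₃ * (1 - θ * c)⁻¹ := mul_nonneg hB₃ hq1
  have hCL : 0 ≤ Bh + θH * (B₀ * (1 - θ * c)⁻¹) * c := add_nonneg hBh (mul_nonneg (mul_nonneg hθH hA₁) hc)
  have hfix1 := fix_of_inverses hI.invG0' hI.invG1
  have hρ0 : 0 ≤ ρ := by linarith
  have htri : Triangle254 (toB6 g R₀ H₀) := fun a b c => hG.tri a b c
  set E : (X → ℝ) →ₗ[ℝ] (PY → ℝ) := 𝔭.ΦY U β ∘ₗ 𝔬.D U with hE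
  set bout := cNormR R₀ H₀ 𝔭.blkPY hG.lenle (β - 1) with hbout
  -- (a) the right entries of G₁ in the real classes: G₁ : 𝔠^{(0)} → 𝔠^{(−2)}, G₁D : W^{(−1)} → 𝔠^{(−2)}, G₁Q* : Z_{wZ} → 𝔠^{(−2)}
  have hG1 : HasMaj (cNormR R₀ H₀ 𝔬.blk hG.lenle 0) (cNormR R₀ H₀ 𝔬.blk hG.lenle (-2)) (𝔬.G1 U ∘ₗ LinearMap.id)
      (fun a b => B₀ * (1 - θ * c)⁻¹ * Real.exp (-(ρ * g.dist a b))) := by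
    rw [LinearMap.comp_id]
    have h := hasMaj_toR hG (hasMaj_entry0_cNorm hG hrow hθ hB₀ hρ0 hρS hρδ hK he0 hfix1 hq)
    simp only [Nat.cast_zero, neg_zero, Nat.cast_ofNat] at h
    exact h
  have hGD : HasMaj (cNormR R₀ H₀ 𝔬.blkW hG.lenle (-1)) (cNormR R₀ H₀ 𝔬.blk hG.lenle (-2)) (𝔬.G1 U ∘ₗ 𝔬.Dv U)
      (fun a b => B₃ * (1 - θ * c)⁻¹ * Real.exp (-(ρ * g.dist a b))) := by
    have h := hasMaj_toR hG (hasMaj_right_of_step hG hrow hθ hB₃ hρ0 hρ₃ hρδ hK hL.gD2 hfix1 hq)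
    simp only [Nat.cast_one, Nat.cast_ofNat] at h
    exact h
  have hGQ : HasMaj (weightNorm (BlockNorm.ofBlocks (toB6 g R₀ H₀) 𝔬.blkZ) wZ fun y => (hwZ y).le) (cNormR R₀ H₀ 𝔬.blk hG.lenle (-2))
      (𝔬.G1 U ∘ₗ 𝔬.Qstar U) (fun a b => B₃ * (1 - θ * c)⁻¹ * Real.exp (-(ρ * g.dist a b))) := by
    have h := hasMaj_toR_tgt hG (hasMaj_right_of_step_weight hG hwZ hrow hθ hB₃ hρ0 hρ₃ hρδ hK hL.gQs2 hfix1 hq)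
    simp only [Nat.cast_ofNat] at h
    exact h
  -- (b) the head E G₀ : 𝔠^{(0)} → 𝔠_P^{(β−1)} from (3.43)₁ for G₀, and E G₁ : 𝔠^{(0)} → 𝔠_P^{(β−1)}
  have hE0 : HasMaj (cNormR R₀ H₀ 𝔬.blk hG.lenle 0) bout (E ∘ₗ 𝔬.G0 U ∘ₗ LinearMap.id) (fun a b => Bh * Real.exp (-(δ₀ * g.dist a b))) := by
    rw [LinearMap.comp_id]
    have h43' : HasMajorantHom (g := toB6 g R₀ H₀) 𝔬.blk 𝔭.blkPY (E ∘ₗ 𝔬.G0 U)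
        (fun (a b : g.Site) => Bh * g.len a ^ (1 - β) * Real.exp (-(δ₀ * g.dist a b))) := h43
    have h := hasMaj_cNormR_of_hasMajorantHom hG (C := fun a b => Bh * Real.exp (-(δ₀ * g.dist a b)))
      (fun a b => mul_nonneg hBh (Real.exp_nonneg _)) (1 - β) 0
      (hasMajorantHom_mono (g := toB6 g R₀ H₀) 𝔬.blk 𝔭.blkPY h43' fun a b => le_of_eq (by simp only [Real.rpow_zero, mul_one]; ring))
    have e : -(1 - β) = β - 1 := by ring
    rw [e] at h
    exact h
  have hKE : HasMaj (cNormR R₀ H₀ 𝔬.blk hG.lenle (-2)) bout (E ∘ₗ 𝔬.G0 U ∘ₗ (𝔬.Tpi U + 𝔬.T2 U))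
      (fun a b => θH * Real.exp (-(δK * g.dist a b))) := hpY
  have hD1 : HasMaj (cNormR R₀ H₀ 𝔬.blk hG.lenle 0) bout (E ∘ₗ 𝔬.G1 U ∘ₗ LinearMap.id)
      (fun y y' => (Bh + θH * (B₀ * (1 - θ * c)⁻¹) * c) * Real.exp (-(ρ * g.dist y y'))) :=
    hasMaj_left_rightR hG hrow hθH hBh hA₁ hρ0 hρS le_rfl hρδ hKE hE0 hG1 hfix1
  -- (c) TERM B = (E G₁D)(RD*G₁) = (E G₀D)(RD*G₁) + ((E G₀T₁)(G₁D))(RD*G₁): the first summand through `bW`, the second through W^{(−1)}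
  have hρ'₃ : ρ' ≤ δ₃ := by linarith
  have hρ'σ₃ : ρ' + σ ≤ δ₃ := by linarith
  have hrgdH' : HasMaj (cNormR R₀ H₀ 𝔬.blk hG.lenle 0) bW (𝔬.R U ∘ₗ 𝔬.Dvstar U ∘ₗ 𝔬.G1 U ∘ₗ LinearMap.id)
      (fun a b => B₃ * Real.exp (-(δ₃ * g.dist a b))) := by
    have h := hasMaj_toR_src hG hrgdH
    simp only [Nat.cast_zero, neg_zero] at h
    exact h
  have hB1 : HasMaj (cNormR R₀ H₀ 𝔬.blk hG.lenle 0) bout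
      ((E ∘ₗ 𝔬.G0 U ∘ₗ 𝔬.Dv U) ∘ₗ (𝔬.R U ∘ₗ 𝔬.Dvstar U ∘ₗ 𝔬.G1 U ∘ₗ LinearMap.id))
      (fun y y' => bW.κ * Bd * B₃ * c * Real.exp (-(ρ' * g.dist y y'))) :=
    hasMaj_comp_exp htri hG.dnn hrow hBd hB₃ hρ' hρ'₃ hρ'σ₃ hpD hrgdH'
  have hrgd2' : HasMaj (cNormR R₀ H₀ 𝔬.blk hG.lenle 0) (cNormR R₀ H₀ 𝔬.blkW hG.lenle (-1))
      (𝔬.R U ∘ₗ 𝔬.Dvstar U ∘ₗ 𝔬.G1 U ∘ₗ LinearMap.id) (fun a b => B₃ * Real.exp (-(δ₃ * g.dist a b))) := by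
    have h := hasMaj_toR hG hL.rgd2
    simp only [Nat.cast_zero, neg_zero, Nat.cast_one] at h
    exact h
  have hGDT : HasMaj (cNormR R₀ H₀ 𝔬.blkW hG.lenle (-1)) bout
      ((E ∘ₗ 𝔬.G0 U ∘ₗ (𝔬.Tpi U + 𝔬.T2 U)) ∘ₗ (𝔬.G1 U ∘ₗ 𝔬.Dv U))
      (fun y y' => (cNormR R₀ H₀ 𝔬.blk hG.lenle (-2) (X := X)).κ * θH * (B₃ * (1 - θ * c)⁻¹) * c *
        Real.exp (-((ρ' + σ) * g.dist y y'))) :=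
    hasMaj_comp_exp htri hG.dnn hrow hθH hA₃ (by linarith) (by linarith) (by linarith) hKE hGD
  simp only [cNormR_κ, one_mul] at hGDT
  have hθA₃ : 0 ≤ θH * (B₃ * (1 - θ * c)⁻¹) * c := mul_nonneg (mul_nonneg hθH hA₃) hc
  have hB2 : HasMaj (cNormR R₀ H₀ 𝔬.blk hG.lenle 0) bout
      (((E ∘ₗ 𝔬.G0 U ∘ₗ (𝔬.Tpi U + 𝔬.T2 U)) ∘ₗ (𝔬.G1 U ∘ₗ 𝔬.Dv U)) ∘ₗ (𝔬.R U ∘ₗ 𝔬.Dvstar U ∘ₗ 𝔬.G1 U ∘ₗ LinearMap.id))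
      (fun y y' => (cNormR R₀ H₀ 𝔬.blkW hG.lenle (-1) (X := W)).κ * (θH * (B₃ * (1 - θ * c)⁻¹) * c) * B₃ * c *
        Real.exp (-(ρ' * g.dist y y'))) :=
    hasMaj_comp_exp htri hG.dnn hrow hθA₃ hB₃ hρ' hρ'₃ le_rfl hGDT hrgd2'
  simp only [cNormR_κ, one_mul] at hB2
  have eB : (E ∘ₗ 𝔬.G1 U ∘ₗ 𝔬.Dv U) ∘ₗ (𝔬.R U ∘ₗ 𝔬.Dvstar U ∘ₗ 𝔬.G1 U ∘ₗ LinearMap.id) =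
      (E ∘ₗ 𝔬.G0 U ∘ₗ 𝔬.Dv U) ∘ₗ (𝔬.R U ∘ₗ 𝔬.Dvstar U ∘ₗ 𝔬.G1 U ∘ₗ LinearMap.id) +
        (((E ∘ₗ 𝔬.G0 U ∘ₗ (𝔬.Tpi U + 𝔬.T2 U)) ∘ₗ (𝔬.G1 U ∘ₗ 𝔬.Dv U)) ∘ₗ
          (𝔬.R U ∘ₗ 𝔬.Dvstar U ∘ₗ 𝔬.G1 U ∘ₗ LinearMap.id)) := by
    rw [comp_fix_left_right E (𝔬.Dv U) hfix1, LinearMap.add_comp]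
  have hB := hB1.add hB2
  rw [← eB] at hB
  -- (d) TERM C = (E G₁Q*)((QG₁Q*)⁻¹QG₁) through the classes Z², Z_{wZ} and the probe head `hpQ`
  have hQG : HasMaj (cNormR R₀ H₀ 𝔬.blk hG.lenle 0) (cNormR R₀ H₀ 𝔬.blkZ hG.lenle (-2)) (𝔬.Q U ∘ₗ (𝔬.G1 U ∘ₗ LinearMap.id))
      (fun a b => (cNormR R₀ H₀ 𝔬.blk hG.lenle (-2) (X := X)).κ * B₃ * (B₀ * (1 - θ * c)⁻¹) * c *
        Real.exp (-((ρ' + 2 * σ) * g.dist a b))) := by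
    have hq2' : HasMaj (cNormR R₀ H₀ 𝔬.blk hG.lenle (-2)) (cNormR R₀ H₀ 𝔬.blkZ hG.lenle (-2)) (𝔬.Q U)
        (fun a b => B₃ * Real.exp (-(δ₃ * g.dist a b))) := by
      have h := hasMaj_toR hG hL.q2
      simp only [Nat.cast_ofNat] at h
      exact h
    exact hasMaj_comp_exp htri hG.dnn hrow hB₃ hA₁ (by linarith) (by linarith) (by linarith) hq2' hG1
  simp only [cNormR_κ, one_mul] at hQG
  have hK₁ : 0 ≤ B₃ * (B₀ * (1 - θ * c)⁻¹) * c := mul_nonneg (mul_nonneg hB₃ hA₁) hc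
  have hc12' : HasMaj (cNormR R₀ H₀ 𝔬.blkZ hG.lenle (-2)) (weightNorm (BlockNorm.ofBlocks (toB6 g R₀ H₀) 𝔬.blkZ) wZ fun y => (hwZ y).le) (𝔬.C1 U)
      (fun a b => B₃ * Real.exp (-(δ₃ * g.dist a b))) := by
    have h := hasMaj_toR_src hG hL.c1_2
    simp only [Nat.cast_ofNat] at h
    exact h
  have hCQG : HasMaj (cNormR R₀ H₀ 𝔬.blk hG.lenle 0) (weightNorm (BlockNorm.ofBlocks (toB6 g R₀ H₀) 𝔬.blkZ) wZ fun y => (hwZ y).le)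
      (𝔬.C1 U ∘ₗ (𝔬.Q U ∘ₗ (𝔬.G1 U ∘ₗ LinearMap.id)))
      (fun a b => (cNormR R₀ H₀ 𝔬.blkZ hG.lenle (-2) (X := Z)).κ * B₃ * (B₃ * (B₀ * (1 - θ * c)⁻¹) * c) * c *
        Real.exp (-((ρ' + σ) * g.dist a b))) :=
    hasMaj_comp_exp htri hG.dnn hrow hB₃ hK₁ (by linarith) (by linarith) (by linarith) hc12' hQG
  simp only [cNormR_κ, one_mul] at hCQG
  have hD1Q : HasMaj (weightNorm (BlockNorm.ofBlocks (toB6 g R₀ H₀) 𝔬.blkZ) wZ fun y => (hwZ y).le) bout (E ∘ₗ 𝔬.G1 U ∘ₗ 𝔬.Qstar U)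
      (fun y y' => (Bq + θH * (B₃ * (1 - θ * c)⁻¹) * c) * Real.exp (-((ρ' + σ) * g.dist y y'))) :=
    hasMaj_left_rightR hG hrow hθH hBq hA₃ (by linarith) (by linarith) (by linarith) (by linarith) hKE hpQ hGQ hfix1
  have hBq' : 0 ≤ Bq + θH * (B₃ * (1 - θ * c)⁻¹) * c := add_nonneg hBq hθA₃
  have hK₂ : 0 ≤ B₃ * (B₃ * (B₀ * (1 - θ * c)⁻¹) * c) * c := mul_nonneg (mul_nonneg hB₃ hK₁) hc
  have hC : HasMaj (cNormR R₀ H₀ 𝔬.blk hG.lenle 0) bout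
      ((E ∘ₗ 𝔬.G1 U ∘ₗ 𝔬.Qstar U) ∘ₗ (𝔬.C1 U ∘ₗ (𝔬.Q U ∘ₗ (𝔬.G1 U ∘ₗ LinearMap.id))))
      (fun y y' => (weightNorm (BlockNorm.ofBlocks (toB6 g R₀ H₀) 𝔬.blkZ) wZ fun y => (hwZ y).le).κ *
        (Bq + θH * (B₃ * (1 - θ * c)⁻¹) * c) *
        (B₃ * (B₃ * (B₀ * (1 - θ * c)⁻¹) * c) * c) * c * Real.exp (-(ρ' * g.dist y y'))) :=
    hasMaj_comp_exp htri hG.dnn hrow hBq' hK₂ hρ' (by linarith) le_rfl hD1Q hCQG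
  simp only [weightNorm_ofBlocks_κ, one_mul] at hC
  -- (e) assembling (3.153) with the left factor E
  have h := ((hD1.of_rate_le hG.dnn hCL (by linarith : ρ' ≤ ρ)).sub hB).sub hC
  rw [← E_GG_eq hI E] at h
  have hC0 : 0 ≤ constH313 (Bh + θH * (B₀ * (1 - θ * c)⁻¹) * c) θH (B₀ * (1 - θ * c)⁻¹) (B₃ * (1 - θ * c)⁻¹) B₃ Bd Bq bW.κ c :=
    constH313_nonneg hCL hθH hA₁ hA₃ hB₃ hBd hBq bW.κ_nonneg hc
  have h2 : HasMaj (cNormR R₀ H₀ 𝔬.blk hG.lenle 0) bout (E ∘ₗ 𝔬.GG U)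
      (fun a b => constH313 (Bh + θH * (B₀ * (1 - θ * c)⁻¹) * c) θH (B₀ * (1 - θ * c)⁻¹) (B₃ * (1 - θ * c)⁻¹) B₃ Bd Bq bW.κ c *
        Real.exp (-(ρ' * g.dist a b))) :=
    h.mono fun a b => le_of_eq (by simp only [constH313, toB6_dist]; ring)
  have h' := hasMajorantHom_of_hasMaj_cNormR hG (fun a b => mul_nonneg hC0 (Real.exp_nonneg _)) h2
  have h'' : HasMajorantHom (g := toB6 g R₀ H₀) 𝔬.blk 𝔭.blkPY (𝔭.ΦY U β ∘ₗ (𝔬.D U ∘ₗ 𝔬.GG U))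
      (fun (a b : g.Site) => constH313 (Bh + θH * (B₀ * (1 - θ * c)⁻¹) * c) θH (B₀ * (1 - θ * c)⁻¹) (B₃ * (1 - θ * c)⁻¹) B₃ Bd Bq bW.κ c *
        Real.exp (-(ρ' * g.dist a b)) * g.len a ^ (-(β - 1)) * g.len b ^ (0 : ℝ)) := h'
  refine hasMajorantHom_mono (g := toB6 g R₀ H₀) 𝔬.blk 𝔭.blkPY h'' fun a b => le_of_eq ?_
  simp only [Real.rpow_zero, mul_one, show -(β - 1) = 1 - β by ring]
  ring

omit [Fintype PY] in
/-- ★ **THEOREM 3.13, THE RIGHT (3.43) MEMBER OF 𝔊 — Φ^X_β∘𝔊∘∇\*_U through (3.153), COARSE LETTERS RE-CLASSED** (statement of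
`B9Thm313WholeHolder.GG_probe43R_of_letters` over `Letters313Z`, `hpQs` out of `Z_{len·wZ}`), the probe twin of `B9Thm313WholeZ.GG_entry2_of_lettersZ`: from Theorem 3.3's
(3.42)₃ (`he2`) and the probe of (3.43)₂ (`h43`) for G₀, the step K′₁ on 𝔠⁽¹⁾ (`hK`, θc < 1) and its probe (`hpX`, θ_He^{−δ_Kd}), the letters of `Letters313`
(`gD1 gQs1 rgd1 c1_1 q1`), the probe letters `hpDv` (ΦG₀D from the scalar sup class) and `hpQs` (ΦG₀Q* from Z_{len·wZ}) of `Letters313HZ`, and (3.153):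
Φ^X_β∘𝔊∘∇\*_U has majorant `constH313 …`·e^{−ρ′d} from 𝔠_Y^{(0)} into 𝔠_P^{(β−1)}, whence the two-space shape C·(Lʲη)^{1−β}e^{−ρ′d}.
[cite: Balaban1985BackgroundPropagators, Thm 3.13 p.426 + (3.152)–(3.153) p.426 + (3.138) p.423 + (3.43) p.398] -/
theorem GG_probe43R_of_lettersZ (hG : GeoOK g) {𝔬 : Ops g B X Y Z W} (𝔭 : HolderProbes g B X Y PX PY) {U : B.Cfg}
    {θ θH B₀ B₃ Bh Bx β δ₀ δ₃ δK ρ ρ' σ c : ℝ} (hrow : RowSum (toB6 g R₀ H₀) σ c) (hc : 0 ≤ c)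
    (hθ : 0 ≤ θ) (hθH : 0 ≤ θH) (hB₀ : 0 ≤ B₀) (hB₃ : 0 ≤ B₃) (hBh : 0 ≤ Bh) (hBx : 0 ≤ Bx) (hσ : 0 ≤ σ) (hρ' : 0 ≤ ρ')
    (hρ'ρ : ρ' + 3 * σ ≤ ρ) (hρS : ρ ≤ δ₀) (hρ₃ : ρ ≤ δ₃) (hρδ : ρ + σ ≤ δK) (hq : θ * c < 1)
    (hK : HasMaj (cNorm R₀ H₀ 𝔬.blk hG.lenle 1) (cNorm R₀ H₀ 𝔬.blk hG.lenle 1) (𝔬.G0 U ∘ₗ (𝔬.Tpi U + 𝔬.T2 U))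
      (fun a b => θ * Real.exp (-(δK * g.dist a b))))
    (he2 : HasMajorantHom (g := toB6 g R₀ H₀) 𝔬.blkY 𝔬.blk (𝔬.G0 U ∘ₗ 𝔬.Dstar U)
      (fun a b => B₀ * g.len a * Real.exp (-(δ₀ * g.dist a b))))
    (h43 : HasMajorantHom (g := toB6 g R₀ H₀) 𝔬.blkY 𝔭.blkPX (𝔭.ΦX U β ∘ₗ (𝔬.G0 U ∘ₗ 𝔬.Dstar U))
      (fun (a b : g.Site) => Bh * g.len a ^ (1 - β) * Real.exp (-(δ₀ * g.dist a b))))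
    (hpX : HasMaj (cNormR R₀ H₀ 𝔬.blk hG.lenle (-1)) (cNormR R₀ H₀ 𝔭.blkPX hG.lenle (β - 1))
      ((𝔭.ΦX U β ∘ₗ 𝔬.G0 U) ∘ₗ (𝔬.Tpi U + 𝔬.T2 U)) (fun a b => θH * Real.exp (-(δK * g.dist a b))))
    (hpDv : HasMaj (cNormR R₀ H₀ 𝔬.blkW hG.lenle 0) (cNormR R₀ H₀ 𝔭.blkPX hG.lenle (β - 1)) ((𝔭.ΦX U β ∘ₗ 𝔬.G0 U) ∘ₗ 𝔬.Dv U)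
      (fun a b => Bx * Real.exp (-(δ₃ * g.dist a b))))
    {wZ : g.Site → ℝ} {hwZ : ∀ y, 0 < wZ y}
    (hpQs : HasMaj (weightNorm (BlockNorm.ofBlocks (toB6 g R₀ H₀) 𝔬.blkZ) (fun y => g.len y * wZ y) fun y => (wZlen_pos hG hwZ y).le)
      (cNormR R₀ H₀ 𝔭.blkPX hG.lenle (β - 1)) ((𝔭.ΦX U β ∘ₗ 𝔬.G0 U) ∘ₗ 𝔬.Qstar U) (fun a b => Bx * Real.exp (-(δ₃ * g.dist a b))))
    (hL : Letters313Z 𝔬 R₀ H₀ hG wZ hwZ B₃ δ₃ U) (hI : Identities 𝔬 U) :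
    HasMajorantHom (g := toB6 g R₀ H₀) 𝔬.blkY 𝔭.blkPX (𝔭.ΦX U β ∘ₗ (𝔬.GG U ∘ₗ 𝔬.Dstar U))
      (fun (a b : g.Site) => constH313 (Bh + θH * (B₀ * (1 - θ * c)⁻¹) * c) θH (B₀ * (1 - θ * c)⁻¹) (B₃ * (1 - θ * c)⁻¹) B₃ Bx Bx 1 c *
        g.len a ^ (1 - β) * Real.exp (-(ρ' * g.dist a b))) := by
  have hq1 : 0 ≤ (1 - θ * c)⁻¹ := inv_nonneg.mpr (by linarith)
  have hA₁ : 0 ≤ B₀ * (1 - θ * c)⁻¹ := mul_nonneg hB₀ hq1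
  have hA₃ : 0 ≤ B₃ * (1 - θ * c)⁻¹ := mul_nonneg hB₃ hq1
  have hCL : 0 ≤ Bh + θH * (B₀ * (1 - θ * c)⁻¹) * c := add_nonneg hBh (mul_nonneg (mul_nonneg hθH hA₁) hc)
  have hfix1 := fix_of_inverses hI.invG0' hI.invG1
  have hρ0 : 0 ≤ ρ := by linarith
  have htri : Triangle254 (toB6 g R₀ H₀) := fun a b c => hG.tri a b c
  set E : (X → ℝ) →ₗ[ℝ] (PX → ℝ) := 𝔭.ΦX U β with hE
  set bout := cNormR R₀ H₀ 𝔭.blkPX hG.lenle (β - 1) with hbout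
  -- (a) the right entries of G₁ in the real classes: G₁∇* : Y^{(0)} → 𝔠^{(−1)}, G₁D : W^{(0)} → 𝔠^{(−1)}, G₁Q* : Z_{len·wZ} → 𝔠^{(−1)}
  have hG1 : HasMaj (cNormR R₀ H₀ 𝔬.blkY hG.lenle 0) (cNormR R₀ H₀ 𝔬.blk hG.lenle (-1)) (𝔬.G1 U ∘ₗ 𝔬.Dstar U)
      (fun a b => B₀ * (1 - θ * c)⁻¹ * Real.exp (-(ρ * g.dist a b))) := by
    have h := hasMaj_toR hG (hasMaj_entry2_cNorm hG hrow hθ hB₀ hρ0 hρS hρδ hK he2 hfix1 hq)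
    simp only [Nat.cast_zero, neg_zero, Nat.cast_one] at h
    exact h
  have hGD : HasMaj (cNormR R₀ H₀ 𝔬.blkW hG.lenle 0) (cNormR R₀ H₀ 𝔬.blk hG.lenle (-1)) (𝔬.G1 U ∘ₗ 𝔬.Dv U)
      (fun a b => B₃ * (1 - θ * c)⁻¹ * Real.exp (-(ρ * g.dist a b))) := by
    have h := hasMaj_toR hG (hasMaj_right_of_step hG hrow hθ hB₃ hρ0 hρ₃ hρδ hK hL.gD1 hfix1 hq)
    simp only [Nat.cast_zero, neg_zero, Nat.cast_one] at h
    exact h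
  have hGQ : HasMaj (weightNorm (BlockNorm.ofBlocks (toB6 g R₀ H₀) 𝔬.blkZ) (fun y => g.len y * wZ y) fun y => (wZlen_pos hG hwZ y).le)
      (cNormR R₀ H₀ 𝔬.blk hG.lenle (-1)) (𝔬.G1 U ∘ₗ 𝔬.Qstar U) (fun a b => B₃ * (1 - θ * c)⁻¹ * Real.exp (-(ρ * g.dist a b))) := by
    have h := hasMaj_toR_tgt hG (hasMaj_right_of_step_weight hG (wZlen_pos hG hwZ) hrow hθ hB₃ hρ0 hρ₃ hρδ hK hL.gQs1 hfix1 hq)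
    simp only [Nat.cast_one] at h
    exact h
  -- (b) the head E G₀∇* : Y^{(0)} → 𝔠_P^{(β−1)} from (3.43)₂ for G₀, and E G₁∇*
  have hE0 : HasMaj (cNormR R₀ H₀ 𝔬.blkY hG.lenle 0) bout (E ∘ₗ 𝔬.G0 U ∘ₗ 𝔬.Dstar U) (fun a b => Bh * Real.exp (-(δ₀ * g.dist a b))) := by
    have h := hasMaj_cNormR_of_hasMajorantHom hG (C := fun a b => Bh * Real.exp (-(δ₀ * g.dist a b)))
      (fun a b => mul_nonneg hBh (Real.exp_nonneg _)) (1 - β) 0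
      (hasMajorantHom_mono (g := toB6 g R₀ H₀) 𝔬.blkY 𝔭.blkPX h43 fun a b => le_of_eq (by simp only [Real.rpow_zero, mul_one]; ring))
    have e : -(1 - β) = β - 1 := by ring
    rw [e] at h
    exact h
  have hKE : HasMaj (cNormR R₀ H₀ 𝔬.blk hG.lenle (-1)) bout (E ∘ₗ 𝔬.G0 U ∘ₗ (𝔬.Tpi U + 𝔬.T2 U))
      (fun a b => θH * Real.exp (-(δK * g.dist a b))) := hpX
  have hD1 : HasMaj (cNormR R₀ H₀ 𝔬.blkY hG.lenle 0) bout (E ∘ₗ 𝔬.G1 U ∘ₗ 𝔬.Dstar U)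
      (fun y y' => (Bh + θH * (B₀ * (1 - θ * c)⁻¹) * c) * Real.exp (-(ρ * g.dist y y'))) :=
    hasMaj_left_rightR hG hrow hθH hBh hA₁ hρ0 hρS le_rfl hρδ hKE hE0 hG1 hfix1
  -- (c) TERM B = (E G₁D)(RD*G₁∇*): E G₁D : W^{(0)} → 𝔠_P^{(β−1)} by the left-and-right entry, then the letter `rgd1`
  have hρ'₃ : ρ' ≤ δ₃ := by linarith
  have hθA₃ : 0 ≤ θH * (B₃ * (1 - θ * c)⁻¹) * c := mul_nonneg (mul_nonneg hθH hA₃) hc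
  have hED : HasMaj (cNormR R₀ H₀ 𝔬.blkW hG.lenle 0) bout (E ∘ₗ 𝔬.G1 U ∘ₗ 𝔬.Dv U)
      (fun y y' => (Bx + θH * (B₃ * (1 - θ * c)⁻¹) * c) * Real.exp (-((ρ' + σ) * g.dist y y'))) :=
    hasMaj_left_rightR hG hrow hθH hBx hA₃ (by linarith) (by linarith) (by linarith) (by linarith) hKE hpDv hGD hfix1
  have hrgd1' : HasMaj (cNormR R₀ H₀ 𝔬.blkY hG.lenle 0) (cNormR R₀ H₀ 𝔬.blkW hG.lenle 0)
      (𝔬.R U ∘ₗ 𝔬.Dvstar U ∘ₗ 𝔬.G1 U ∘ₗ 𝔬.Dstar U) (fun a b => B₃ * Real.exp (-(δ₃ * g.dist a b))) := by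
    have h := hasMaj_toR hG hL.rgd1
    simp only [Nat.cast_zero, neg_zero] at h
    exact h
  have hBx' : 0 ≤ Bx + θH * (B₃ * (1 - θ * c)⁻¹) * c := add_nonneg hBx hθA₃
  have hB : HasMaj (cNormR R₀ H₀ 𝔬.blkY hG.lenle 0) bout
      ((E ∘ₗ 𝔬.G1 U ∘ₗ 𝔬.Dv U) ∘ₗ (𝔬.R U ∘ₗ 𝔬.Dvstar U ∘ₗ 𝔬.G1 U ∘ₗ 𝔬.Dstar U))
      (fun y y' => (cNormR R₀ H₀ 𝔬.blkW hG.lenle 0 (X := W)).κ * (Bx + θH * (B₃ * (1 - θ * c)⁻¹) * c) * B₃ * c *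
        Real.exp (-(ρ' * g.dist y y'))) :=
    hasMaj_comp_exp htri hG.dnn hrow hBx' hB₃ hρ' hρ'₃ le_rfl hED hrgd1'
  simp only [cNormR_κ, one_mul] at hB
  -- (d) TERM C = (E G₁Q*)((QG₁Q*)⁻¹QG₁∇*) through Y⁰ → Z¹ → Z_{len·wZ}
  have hq1' : HasMaj (cNormR R₀ H₀ 𝔬.blk hG.lenle (-1)) (cNormR R₀ H₀ 𝔬.blkZ hG.lenle (-1)) (𝔬.Q U)
      (fun a b => B₃ * Real.exp (-(δ₃ * g.dist a b))) := by
    have h := hasMaj_toR hG hL.q1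
    simp only [Nat.cast_one] at h
    exact h
  have hQG : HasMaj (cNormR R₀ H₀ 𝔬.blkY hG.lenle 0) (cNormR R₀ H₀ 𝔬.blkZ hG.lenle (-1)) (𝔬.Q U ∘ₗ (𝔬.G1 U ∘ₗ 𝔬.Dstar U))
      (fun a b => (cNormR R₀ H₀ 𝔬.blk hG.lenle (-1) (X := X)).κ * B₃ * (B₀ * (1 - θ * c)⁻¹) * c *
        Real.exp (-((ρ' + 2 * σ) * g.dist a b))) :=
    hasMaj_comp_exp htri hG.dnn hrow hB₃ hA₁ (by linarith) (by linarith) (by linarith) hq1' hG1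
  simp only [cNormR_κ, one_mul] at hQG
  have hK₁ : 0 ≤ B₃ * (B₀ * (1 - θ * c)⁻¹) * c := mul_nonneg (mul_nonneg hB₃ hA₁) hc
  have hc11' : HasMaj (cNormR R₀ H₀ 𝔬.blkZ hG.lenle (-1)) (weightNorm (BlockNorm.ofBlocks (toB6 g R₀ H₀) 𝔬.blkZ) (fun y => g.len y * wZ y) fun y => (wZlen_pos hG hwZ y).le)
      (𝔬.C1 U) (fun a b => B₃ * Real.exp (-(δ₃ * g.dist a b))) := by
    have h := hasMaj_toR_src hG hL.c1_1
    simp only [Nat.cast_one] at h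
    exact h
  have hCQG : HasMaj (cNormR R₀ H₀ 𝔬.blkY hG.lenle 0) (weightNorm (BlockNorm.ofBlocks (toB6 g R₀ H₀) 𝔬.blkZ) (fun y => g.len y * wZ y) fun y => (wZlen_pos hG hwZ y).le)
      (𝔬.C1 U ∘ₗ (𝔬.Q U ∘ₗ (𝔬.G1 U ∘ₗ 𝔬.Dstar U)))
      (fun a b => (cNormR R₀ H₀ 𝔬.blkZ hG.lenle (-1) (X := Z)).κ * B₃ * (B₃ * (B₀ * (1 - θ * c)⁻¹) * c) * c *
        Real.exp (-((ρ' + σ) * g.dist a b))) :=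
    hasMaj_comp_exp htri hG.dnn hrow hB₃ hK₁ (by linarith) (by linarith) (by linarith) hc11' hQG
  simp only [cNormR_κ, one_mul] at hCQG
  have hD1Q : HasMaj (weightNorm (BlockNorm.ofBlocks (toB6 g R₀ H₀) 𝔬.blkZ) (fun y => g.len y * wZ y) fun y => (wZlen_pos hG hwZ y).le) bout
      (E ∘ₗ 𝔬.G1 U ∘ₗ 𝔬.Qstar U) (fun y y' => (Bx + θH * (B₃ * (1 - θ * c)⁻¹) * c) * Real.exp (-((ρ' + σ) * g.dist y y'))) :=
    hasMaj_left_rightR hG hrow hθH hBx hA₃ (by linarith) (by linarith) (by linarith) (by linarith) hKE hpQs hGQ hfix1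
  have hK₂ : 0 ≤ B₃ * (B₃ * (B₀ * (1 - θ * c)⁻¹) * c) * c := mul_nonneg (mul_nonneg hB₃ hK₁) hc
  have hC : HasMaj (cNormR R₀ H₀ 𝔬.blkY hG.lenle 0) bout
      ((E ∘ₗ 𝔬.G1 U ∘ₗ 𝔬.Qstar U) ∘ₗ (𝔬.C1 U ∘ₗ (𝔬.Q U ∘ₗ (𝔬.G1 U ∘ₗ 𝔬.Dstar U))))
      (fun y y' => (weightNorm (BlockNorm.ofBlocks (toB6 g R₀ H₀) 𝔬.blkZ) (fun y => g.len y * wZ y) fun y => (wZlen_pos hG hwZ y).le).κ *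
        (Bx + θH * (B₃ * (1 - θ * c)⁻¹) * c) *
        (B₃ * (B₃ * (B₀ * (1 - θ * c)⁻¹) * c) * c) * c * Real.exp (-(ρ' * g.dist y y'))) :=
    hasMaj_comp_exp htri hG.dnn hrow hBx' hK₂ hρ' (by linarith) le_rfl hD1Q hCQG
  simp only [weightNorm_ofBlocks_κ, one_mul] at hC
  -- (e) assembling (3.153) with E on the left and ∇* on the right
  have h := ((hD1.of_rate_le hG.dnn hCL (by linarith : ρ' ≤ ρ)).sub hB).sub hC
  rw [← E_GG_F_eq hI E (𝔬.Dstar U)] at h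
  have hC0 : 0 ≤ constH313 (Bh + θH * (B₀ * (1 - θ * c)⁻¹) * c) θH (B₀ * (1 - θ * c)⁻¹) (B₃ * (1 - θ * c)⁻¹) B₃ Bx Bx 1 c :=
    constH313_nonneg hCL hθH hA₁ hA₃ hB₃ hBx hBx zero_le_one hc
  have h2 : HasMaj (cNormR R₀ H₀ 𝔬.blkY hG.lenle 0) bout (E ∘ₗ (𝔬.GG U ∘ₗ 𝔬.Dstar U))
      (fun a b => constH313 (Bh + θH * (B₀ * (1 - θ * c)⁻¹) * c) θH (B₀ * (1 - θ * c)⁻¹) (B₃ * (1 - θ * c)⁻¹) B₃ Bx Bx 1 c *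
        Real.exp (-(ρ' * g.dist a b))) :=
    h.mono fun a b => le_of_eq (by simp only [constH313, toB6_dist]; ring)
  have h' := hasMajorantHom_of_hasMaj_cNormR hG (fun a b => mul_nonneg hC0 (Real.exp_nonneg _)) h2
  have h'' : HasMajorantHom (g := toB6 g R₀ H₀) 𝔬.blkY 𝔭.blkPX (𝔭.ΦX U β ∘ₗ (𝔬.GG U ∘ₗ 𝔬.Dstar U))
      (fun (a b : g.Site) => constH313 (Bh + θH * (B₀ * (1 - θ * c)⁻¹) * c) θH (B₀ * (1 - θ * c)⁻¹) (B₃ * (1 - θ * c)⁻¹) B₃ Bx Bx 1 c *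
        Real.exp (-(ρ' * g.dist a b)) * g.len a ^ (-(β - 1)) * g.len b ^ (0 : ℝ)) := h'
  refine hasMajorantHom_mono (g := toB6 g R₀ H₀) 𝔬.blkY 𝔭.blkPX h'' fun a b => le_of_eq ?_
  simp only [Real.rpow_zero, mul_one, show -(β - 1) = 1 - β by ring]
  ring

end OneMember

end

end Literature.MathematicalPhysics.QuantumFieldTheory.Balaban1983to89.B9Thm313WholeHolderZ
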